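import Summits.ResolutionOfSingularities.ResolutionOfSingularities.Theorems.PurelyInseparableDim4JointForestFinitePlanKit
import HarnessLib

/-!
# Purely inseparable four-folds: the finite-plan certificate kit with SEVERAL SEPARATED MEMBERS (brick S3 (c) «joint point∘coordinate
# chains», part 28b, cell `res-dim4-pi`)

[OURS · counted 0] (D-0157 DOOR 2; desk WORD #66 (4)(c), #74 (g), #99 (d); frame `PIDim4.TerminationImpliesOrderReduction`,
S3 (c); host item stmt-ResolutionOfSingularities-16155, helper). Nothing here proves resolution of singularities in
dimension ≥ 4 / characteristic `p` — NOT here, not anywhere in this programme.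

Part 28's kit fixes ONE initial member. Here the root carries finitely many pairwise SEPARATED members `(b, S)` (translated coordinate
subspaces, as in g3's two-member instance p676008), together containing every root parameter; the rules `plan` / `leaves`, the closed
ranked finite set `Q` (now containing every member's root pair `((deletePthPowers p (F(x + b)), 0, ∅), S)`) and the per-pair conditions
are as in part 28 (dead leaves, normalised cover).

* **`exists_isMarkedResolution_finite_plan_cert_members`**.

AI-produced formalisation, weaker than expert review. bears_on: LADDER-RESOLUTION:D157-DOOR2 (res-dim4-pi · S3 (c) joint v2 · kit).
-/

set_option linter.dupNamespace false -- D-0017: single-problem summit path `Summit.<S>.<S>.…` by design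

noncomputable section

open MvPolynomial Finset CategoryTheory AlgebraicGeometry Opposite TopologicalSpace

namespace Summit.ResolutionOfSingularities.ResolutionOfSingularities.Theorems.PIDim4

open Literature.AlgebraicGeometry.Resolution
open Literature.AlgebraicGeometry.Resolution.Hauser2010
open Literature.AlgebraicGeometry.Resolution.AffinePointBlowup (P A γ coord Wtop ξ)

namespace Equimultiple

section KitMembers

variable {K : Type} [Field K] {p : ℕ} [hp : Fact p.Prime] [CharP K p]

/-- **FINITE-PLAN CERTIFICATE KIT, SEVERAL MEMBERS.** See the module docstring. [cite: BierstoneGrigorievMilmanWlodarczyk2011, Def. 3.1.3]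
[cite: HauserPerlega2019PRIMS, §2] [cite: Hauser2010, §F (equiconstant points)] -/
theorem exists_isMarkedResolution_finite_plan_cert_members [IsAlgClosed K] [DecidableEq K] (F : MvPolynomial (Fin 4) K) (hF : F ≠ 0)
    (hclean : Literature.Barriers.ResolutionOfSingularities.HauserPerlega.IsClean p F)
    (mem : Finset ((Fin 4 → K) × Finset (Fin 4)))
    (hmem : ∀ bS ∈ mem, IsPermissibleCentre p bS.2 (deletePthPowers p (PointBlowup.translate bS.1 F)))
    (hsep : ∀ bS ∈ mem, ∀ bS' ∈ mem, bS ≠ bS' → ∃ i ∈ bS.2, i ∈ bS'.2 ∧ bS.1 i ≠ bS'.1 i)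
    (hroots : ∀ b' : Fin 4 → K, (∀ d : Fin 4 →₀ ℕ, d ≠ 0 → d.degree < p → coeff d (PointBlowup.translate b' F) = 0) →
      ∃ bS ∈ mem, ∀ i ∈ bS.2, b' i = bS.1 i)
    (plan : State K → Finset (Fin 4) → Finset (Fin 4 × (Fin 4 → K) × Finset (Fin 4)))
    (leaves : State K → Finset (Fin 4) → Finset (Fin 4 × (Fin 4 → K)))
    (Q : Finset (State K × Finset (Fin 4)))
    (hq₀ : ∀ bS ∈ mem, ((⟨deletePthPowers p (PointBlowup.translate bS.1 F), 0, ∅⟩ : State K), bS.2) ∈ Q)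
    (hclosed : ∀ q ∈ Q, ∀ e ∈ plan q.1 q.2, (CentreBlowup.step p q.2 e.1 e.2.1 q.1, e.2.2) ∈ Q)
    (rk : State K × Finset (Fin 4) → ℕ)
    (hrk : ∀ q ∈ Q, ∀ e ∈ plan q.1 q.2, rk (CentreBlowup.step p q.2 e.1 e.2.1 q.1, e.2.2) < rk q)
    (hP1 : ∀ q ∈ Q, ∀ e ∈ plan q.1 q.2, e.1 ∈ q.2 ∧ e.2.1 e.1 = 0 ∧ q.2 ⊆ e.2.2 ∧
      CentreBlowup.IsEquimultiplePoint p q.2 e.1 e.2.1 q.1 ∧ IsPermissibleCentre p e.2.2 (CentreBlowup.step p q.2 e.1 e.2.1 q.1).F)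
    (hP2 : ∀ q ∈ Q, ∀ e ∈ plan q.1 q.2, ∀ e' ∈ plan q.1 q.2, e ≠ e' →
      (e.1 = e'.1 ∧ ∃ i ∈ e.2.2, i ∈ e'.2.2 ∧ e.2.1 i ≠ e'.2.1 i) ∨
      (e.1 ≠ e'.1 ∧ ((e'.2.1 e.1 = 0 ∧ e.1 ∈ e'.2.2) ∨ (e.2.1 e'.1 = 0 ∧ e'.1 ∈ e.2.2))))
    (hdead : ∀ q ∈ Q, ∀ l ∈ leaves q.1 q.2, ∀ (k : Fin 4) (c : Fin 4 → K), c k = 0 →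
      ¬ CentreBlowup.IsEquimultiplePoint p Finset.univ k c (CentreBlowup.step p q.2 l.1 l.2 q.1))
    (hcover : ∀ q ∈ Q, ∀ (j' : Fin 4) (b' : Fin 4 → K), j' ∈ q.2 → b' j' = 0 → (∀ k ∈ q.2, k < j' → b' k = 0) →
      CentreBlowup.IsEquimultiplePoint p q.2 j' b' q.1 →
      (∃ e ∈ plan q.1 q.2, e.1 = j' ∧ ∀ i ∈ e.2.2, b' i = e.2.1 i) ∨ (j', b') ∈ leaves q.1 q.2) :
    ∃ (X' : Scheme.{0}) (ρ : X' ⟶ P 4 K) (M' : MarkedIdeal X'),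
      IsMarkedResolution (⟨hypSheaf p F, [], p⟩ : MarkedIdeal (P 4 K)) ρ M' := by
  classical
  refine exists_isMarkedResolution_joint_forest_root_normalised F hF hclean plan leaves mem (fun bS hbS => ?_) hsep
    (Set.finite_empty.subset ?_) (fun b' H hoff => ?_)
  · refine ⟨hmem bS hbS, fun q hq => ?_, acc_plan_of_rank plan Q hclosed rk hrk _ (hq₀ bS hbS)⟩
    have hqQ : q ∈ Q := mem_of_reflTransGen_plan plan Q hclosed (hq₀ bS hbS) hq
    exact ⟨hP1 q hqQ, hP2 q hqQ, fun l hl _ => ⟨acc_edge_of_no_pairs _ (hdead q hqQ l hl),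
      fun s' hs' => finite_pairs_of_no_pairs _ (hdead q hqQ l hl) s' hs'⟩, hcover q hqQ⟩
  · rintro b' ⟨H, hoff'⟩
    obtain ⟨bS, hbS, hagree⟩ := hroots b' H
    exact hoff' bS hbS hagree
  · exfalso
    obtain ⟨bS, hbS, hagree⟩ := hroots b' H
    exact hoff bS hbS hagree

end KitMembers

end Equimultiple

end Summit.ResolutionOfSingularities.ResolutionOfSingularities.Theorems.PIDim4

end
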